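import Summits.HodgeConjecture.HodgeConjecture.Theses.LinearSystemTorelli
import Literature.AlgebraicGeometry.HodgeTheory.ClassesSupportedOn
import Literature.AlgebraicGeometry.HodgeTheory.HodgeClassesCupPairing
import Literature.AlgebraicGeometry.HodgeTheory.LocallyTrivialExtensionClasses
import Literature.AlgebraicGeometry.Hyperkaehler.K3HilbertType

/-!
# Sketch — crux idea `green-griffiths-defect-sheaf` for MiddleDivisorSupportFourfold (stmt-HodgeConjecture-2409)

First lemma of the line (crux-ideate, round 1, ideator 1): the VISIBILITY reduction of
de Cataldo–Migliorini (arXiv:0711.1307 §4, n = 2, unconditional because HC holds on threefolds)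
typed on the tree's carriers, and its kernel-checked composition to the crux.

* `VisibleOnDivisors`  — THE BET (equivalent to the crux): a non-zero rational (2,2)-class on a
  smooth projective fourfold that is cup-orthogonal to all algebraic surface classes pairs
  non-trivially with SOME class supported on SOME divisor `Z` (any singularities): `ζ|_Z ≠ 0`.
  The card's lever (four-term defect-sheaf sequence) attacks exactly this statement.
* `ThreefoldDetection` — M-sized, provable from tree facts (Deligne 1974 8.2.8
  `Deligne1974_ker_restrictCompl_eq_iSup_range_complexGysin`, Hironaka, hard Lefschetz on
  threefolds `nonempty_hardLefschetzThreefold`, `lefschetzOneOne_rational`, perfect pairing on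
  threefolds `hodgeClasses_cupPairing_nondegenerate 3`, `complexGysin_mem_algebraicClasses`):
  a rational (2,2)-class pairing non-trivially with a divisor-supported class pairs non-trivially
  with an ALGEBRAIC surface class (dCM 0711.1307, last paragraph of §4).
* `PairingSplit` — S-sized linear algebra over the named fact
  `hodgeClasses_cupPairing_nondegenerate 4 X` (BFNP (6.1)) + finite-dimensionality of `H⁴(X,ℚ)`:
  if no non-zero Hodge class is orthogonal to `Alg²`, then `Hdg⁴ = Alg²` (dCM Fact 4.1).
* `middleDivisorSupportFourfold_of` — the composition, proved here (no sorry), concluding the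
  route decl BY NAME.
-/

namespace Summit.HodgeConjecture.HodgeConjecture.Cruxes.MiddleDivisorSupportFourfold.DefectSheaf

open Literature.AlgebraicGeometry Literature.AlgebraicGeometry.HodgeTheory
open Literature.AlgebraicTopology.SingularHomology

/-- Degree bookkeeping `H⁴ ∪ H⁴ → H⁸`. -/
theorem h44 : (4 : ℕ) + 4 = 4 + 4 := rfl

/-- THE BET. Every non-zero rational `(2,2)`-class `c` on a smooth projective fourfold that is
cup-orthogonal to all algebraic classes of codimension 2 (`supportedClasses X 4 2 =
algebraicClasses X 2`) is VISIBLE on some divisor: there is a Zariski-closed `Z ⊊ X` of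
codimension `≥ 1` and a class `a` supported on `Z` (`a ∈ ker (H⁴(X) → H⁴(X ∖ Z))`) with
`c ∪ a ≠ 0` — equivalently `c|_{Z(ℂ)} ≠ 0`. By dCM 0711.1307 Prop. 3.7/Cor. 3.12 this is the
non-vanishing of the local Green–Griffiths invariant `s(c)_p` at some point `p` of `|mL|`, `m ≫ 0`;
the card computes its cokernel sheaf-theoretically. -/
def VisibleOnDivisors : Prop :=
  ∀ ⦃X : Motives.SchemeOver ℂ⦄, Motives.IsSmoothProjective 4 X →
    ∀ c : complexBetti X 4, IsRationalClass c → IsOfHodgeType 4 X 4 2 2 c → c ≠ 0 →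
      (∀ a ∈ supportedClasses X 4 2, cupProduct h44 c a = 0) →
      ∃ (Z : Set X.left), IsClosed Z ∧ (∀ z ∈ Z, (1 : ℕ∞) ≤ Order.coheight z) ∧
        ∃ a ∈ classesSupportedOn X Z 4, cupProduct h44 c a ≠ 0

/-- THREEFOLD DETECTION (dCM §4, n = 2; unconditional since HC holds in every codimension on
smooth projective threefolds): if a rational `(2,2)`-class pairs non-trivially with a class
supported on a divisor `Z`, it pairs non-trivially with an algebraic surface class. Proof plan:
`ker(H⁴(X) → H⁴(X∖Z)) = Σ Gysin images of H²(Z̃ᵢ)(−1)` for a resolution (Deligne 8.2.8, tree fact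
`Deligne1974_ker_restrictCompl_eq_iSup_range_complexGysin`); so `π^* c ≠ 0` on some smooth
projective threefold `Z̃ᵢ`; `H⁴(Z̃ᵢ) = L · H²(Z̃ᵢ)` (hard Lefschetz) and Hodge classes there are
`L · NS` (Lefschetz (1,1)); perfect pairing on `Z̃ᵢ` gives a divisor class `s` with
`π^*c ∪ s ≠ 0`, and `π_* s` is algebraic (`complexGysin_mem_algebraicClasses`). -/
def ThreefoldDetection : Prop :=
  ∀ ⦃X : Motives.SchemeOver ℂ⦄, Motives.IsSmoothProjective 4 X →
    ∀ (Z : Set X.left), IsClosed Z → (∀ z ∈ Z, (1 : ℕ∞) ≤ Order.coheight z) →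
      ∀ c : complexBetti X 4, IsRationalClass c → IsOfHodgeType 4 X 4 2 2 c →
        (∃ a ∈ classesSupportedOn X Z 4, cupProduct h44 c a ≠ 0) →
        ∃ a ∈ supportedClasses X 4 2, cupProduct h44 c a ≠ 0

/-- PAIRING SPLIT (dCM Fact 4.1 / BFNP (6.1), S-sized given the named fact
`hodgeClasses_cupPairing_nondegenerate 4 X` and `dim_ℚ H⁴(X,ℚ) < ∞`): if every non-zero rational
`(2,2)`-class pairs non-trivially with some algebraic class then `Hdg⁴ = Alg²`. -/
def PairingSplit : Prop :=
  ∀ ⦃X : Motives.SchemeOver ℂ⦄, Motives.IsSmoothProjective 4 X →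
    (∀ c : complexBetti X 4, IsRationalClass c → IsOfHodgeType 4 X 4 2 2 c → c ≠ 0 →
        ∃ a ∈ supportedClasses X 4 2, cupProduct h44 c a ≠ 0) →
    ∀ c : complexBetti X 4, IsRationalClass c → IsOfHodgeType 4 X 4 2 2 c →
      c ∈ supportedClasses X 4 2

/-- COMPOSITION (kernel-checked): visibility on divisors + threefold detection + pairing split
give the crux `LinearSystemTorelli.MiddleDivisorSupportFourfold` by name
(`algebraicClasses X 2 = supportedClasses X 4 2 ≤ supportedClasses X 4 1`). -/
theorem middleDivisorSupportFourfold_of (hV : VisibleOnDivisors) (hT : ThreefoldDetection)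
    (hP : PairingSplit) :
    Summit.HodgeConjecture.HodgeConjecture.Theses.LinearSystemTorelli.MiddleDivisorSupportFourfold := by
  intro X hX c hc hh
  have key : ∀ c : complexBetti X 4, IsRationalClass c → IsOfHodgeType 4 X 4 2 2 c → c ≠ 0 →
      ∃ a ∈ supportedClasses X 4 2, cupProduct h44 c a ≠ 0 := by
    intro c hc hh hne
    by_contra hno
    push_neg at hno
    obtain ⟨Z, hZ, hcod, hvis⟩ := hV hX c hc hh hne hno
    obtain ⟨a, ha, hne'⟩ := hT hX Z hZ hcod c hc hh hvis
    exact hne' (hno a ha)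
  exact supportedClasses_mono X 4 (by norm_num : 1 ≤ 2) (hP hX key c hc hh)

/-! ### The route's object, for reference: LocTriv is typed (definitions landed 2026-08-15/16)

`LocTriv_L = locallyTrivialClasses ι V s Δ(ℂ)` of `HodgeTheory/LocallyTrivialExtensionClasses`.
The card's four-term sequence `0 → LocTriv_L → H⁴_prim(X) → H⁰(P_L, 𝒢𝒢_L) → H²(P_L, j_*R³) → 0`
(odd-vanishing `X`) is a statement about perverse sheaves / IC complexes, which the tree does not
have; it is carried informally by the card. The typed shadow available now: LocTriv is the
intersection of the local restriction kernels, and enlarging the set of centres shrinks it. -/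

open CategoryTheory in
/-- Typed shadow of "the singularity map is the product of the local restrictions": LocTriv along
`D` lies in the local kernel at every `t₀ ∈ D` (antitonicity of `locallyTrivialClasses`). -/
theorem locTriv_le_localKernel {k : Type} [Field k] {S T : Type} [TopologicalSpace S]
    [TopologicalSpace T] (ι : C(S, T)) (V : Motives.LocalSystem k S) (s : S) {D : Set T} {t₀ : T}
    (ht : t₀ ∈ D) :
    locallyTrivialClasses ι V s D ≤ localKernel ι V s t₀ :=
  iInf₂_le t₀ ht


/-! ### Card 2 (`hk-endomorphism-trichotomy`): the K3^[2]-type sector of the crux, typed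

The crux restricted to fourfolds of `K3^[2]`-type (`Hyperkaehler.IsOfK3HilbertSquareType`, landed
definition). The card's theorem-candidate: this holds whenever the endomorphism field
`E = End_Hdg(T(X) ⊗ ℚ)` is `ℚ` or CM (Markman 2204.00516 Thm 1.1 + Charles–Markman standard
conjecture B for `K3^[n]`-type + Huybrechts' unitary spanning lemma), leaving real multiplication. -/

/-- SECTOR STATEMENT: `MiddleDivisorSupportFourfold` for projective fourfolds of `K3^[2]`-type. -/
def K3SquareTypeSector : Prop :=
  ∀ ⦃X : Motives.SchemeOver ℂ⦄, Hyperkaehler.IsOfK3HilbertSquareType X →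
    Motives.IsSmoothProjective 4 X →
      ∀ c : complexBetti X 4, IsRationalClass c → IsOfHodgeType 4 X 4 2 2 c →
        c ∈ supportedClasses X 4 1

/-- The sector statement is an instance of the crux (sanity: it is a genuine weakening, usable as one
stub of a sector-decomposed line). -/
theorem k3SquareTypeSector_of_crux
    (h : Summit.HodgeConjecture.HodgeConjecture.Theses.LinearSystemTorelli.MiddleDivisorSupportFourfold) :
    K3SquareTypeSector :=
  fun _ _ hX c hc hh => h hX c hc hh

end Summit.HodgeConjecture.HodgeConjecture.Cruxes.MiddleDivisorSupportFourfold.DefectSheaf
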